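import Summits.BirchSwinnertonDyer.BirchSwinnertonDyer.Theorems.QuadraticBranchSignedControlEtaLayerLocalTransport
import Summits.BirchSwinnertonDyer.Rank1Residual.Additive.CyclotomicTowerSignedSelmer
import HarnessLib

/-!
# Base change of local Selmer conditions along `subgroupH1Iso`, file 2: Kobayashi's SIGNED LOCAL
# POINTS correspond under the point transport `ψ = (ι₂⁻¹)_*`
(cell `bsd-potss`, seat `bsd-potss-k8q-c3` g2; rung K8, route `QuadraticBranchSignedControl`, crux
`EtaTransportSigned` (stmt-BirchSwinnertonDyer-19115), child `EtaLayerComparison`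
(stmt-BirchSwinnertonDyer-19583))

WHAT. In the two-way local package of file 1 (`…EtaLayerLocalTransport.lean`: `K ⊆ L`, a
`K`-completion `E`, an `L`-completion `E'`, `ι₂ : Ē ≃ Ē'` compatible with `ι : K̄ → Ē`,
`ι' : L̄ → Ē'`, `f : E → E'`; the fixing hypothesis `hfix` for `galRange L`), let
`U : ℕ → Subgroup Γ_K` be a tower BELOW `galRange L` (cc-typer-6's `towerSubgroup κ L`, the
`Γ_K`-internal `Gal(K̄/L·K_m)`) and `κL` a `ℤ_p`-extension of `L` whose layers are the preimages
`res⁻¹(U m)` (ctrl's `restrictGal`, `layerSubgroup_restrictGal`). Then the point transport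
`ψ : E_L(Ē') → E(Ē)` carries
* §1 the points fixed by `(U m)^L_{ι'}` onto the points fixed by `(U m)_ι`
  (`transportPoints_mem_localFixedPointsOfEmb_iff`: `θ_m : (U m)_ι → (U m)^L_{ι'}` is ONTO by the
  inverse transport of file 1);
* §2 Kobayashi's traces onto cc-typer-6's traces (`transportPoints_localPairTraceOfEmb`: `θ` induces
  a bijection of the coset spaces, the trace of a fixed point is the sum over ANY system of
  representatives — the argument of seat g0's `map_localTraceOfEmb_eq` with «`r` onto» replaced by
  the fixing hypothesis);
* §3 **`map_transportPoints_signedLocalPointsOfEmb_one`**: Kobayashi's PLUS local points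
  `E⁺(L_m'·E')` of `W_L` over the `κL`-layers (Def. 1.1, `Kobayashi2003.signedLocalPointsOfEmb … 1 n`)
  onto cc-typer-6's plus local points of `W` over the tower `U` (§2 p. 4,
  `towerSignedLocalPointsOfEmb U ι W 1 n`) — SAME groups `E⁺` seen from `L` or from `K`
  (the ramified prime of `F = ℚ(√p*)` included: both sides are the points over the SAME local
  fields `F_𝔭·F_m = ℚ_p·F·ℚ_m`, no index-2 discrepancy).

HONEST FRAMING (cell `bsd-potss`, run/shared/lean/pub/bsd-potss/; FULL-BSD rank ≤ 1 programme):
INFRASTRUCTURE THEOREMS ONLY — no definition, no named Literature fact, no `sorry`, axioms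
standard; nothing about (C1_η), Kobayashi's theorems or `BSD(W, p)` is claimed; no label or count
moves. Helper toward item 19583 (sign `+` only; the tower minus group carries the printed `m = −1`
clause which Def. 1.1 lacks, so no such identity is claimed for `ε = −1`).

References: [Kobayashi2003] Def. 1.1 (p. 2), §2 p. 4, Def. 2.1 (p. 5) (the groups `E^±`, the trace
maps `Tr_{n/m+1}`); [SerreGaloisCohomology1997] II.§1.1.
-/

set_option autoImplicit false
set_option linter.dupNamespace false

noncomputable section

open scoped Classical

open Literature.NumberTheory.EllipticCurves
open Summit.BirchSwinnertonDyer.Rank1Residual.Additive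
open Summit.BirchSwinnertonDyer.Rank1Residual.Additive.LocalTransport
open Summit.BirchSwinnertonDyer.Rank1Residual.Additive.BaseChange

universe u

namespace Summit.BirchSwinnertonDyer.BirchSwinnertonDyer.Theorems.EtaLayer

variable {K : Type u} [Field K] (L : Type u) [Field L] [Algebra K L] [Algebra.IsAlgebraic K L]
variable {E : Type u} [Field E] [Algebra K E] {E' : Type u} [Field E'] [Algebra L E']
  [Algebra K E'] [IsScalarTower K L E']
variable (ι : AlgebraicClosure K →ₐ[K] AlgebraicClosure E)
  (ι₂ : AlgebraicClosure E ≃+* AlgebraicClosure E')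
  (ι' : AlgebraicClosure L →ₐ[L] AlgebraicClosure E')
  (hcompat : ∀ z : AlgebraicClosure K, ι' (closureEmb (K := K) L z) = ι₂ (ι z))
  (f : E →+* E')
  (hf : ∀ y : E, ι₂ (algebraMap E (AlgebraicClosure E) y) = algebraMap E' (AlgebraicClosure E') (f y))
  (hfixL : ∀ h : Field.absoluteGaloisGroup E, resGalOfEmb ι h ∈ galRange (K := K) L → ∀ y : E',
    (show AlgebraicClosure E ≃ₐ[E] AlgebraicClosure E from h)
      (ι₂.symm (algebraMap E' (AlgebraicClosure E') y)) =
        ι₂.symm (algebraMap E' (AlgebraicClosure E') y))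
  (W : WeierstrassCurve K)

/-! ## §1 Fixed points correspond -/

section Fixed

variable (H : Subgroup (Field.absoluteGaloisGroup K)) (H' : Subgroup (Field.absoluteGaloisGroup L))
  (hH : H ≤ galRange (K := K) L)
  (hHH' : ∀ τ : Field.absoluteGaloisGroup L, resGal (K := K) L τ ∈ H → τ ∈ H')
  (hH'H : ∀ τ : Field.absoluteGaloisGroup L, τ ∈ H' → resGal (K := K) L τ ∈ H)

include hcompat hfixL hH hHH' in
/-- **Equivariance, unbundled**: `ψ ((ι₂ h ι₂⁻¹) • Q) = h • ψ Q` for `h ∈ Γ_E` restricting into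
`H ≤ galRange L` (the tree's `transportPoints_smul`). [cite: SerreGaloisCohomology1997, I.§2.4] -/
theorem transportPoints_transportAut_smul (h : Field.absoluteGaloisGroup E) (hh : resGalOfEmb ι h ∈ H)
    (Q : localPoints (W.baseChange L) E') :
    transportPoints L ι ι₂ ι' hcompat W (transportAut ι₂ h (hfixL h (hH hh)) • Q) =
      h • transportPoints L ι ι₂ ι' hcompat W Q := by
  have key := transportPoints_smul L H H' hHH' ι ι₂ ι' hcompat (fun g hg => hfixL g (hH hg)) W
    ⟨h, hh⟩ Q
  rw [Subgroup.smul_def, Subgroup.smul_def, coe_transportHom_apply] at key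
  exact key

include hcompat f hf hfixL hH hHH' hH'H in
/-- **Fixed points correspond**: `ψ Q` is fixed by `H_ι` IFF `Q` is fixed by `H'_{ι'}` (`H'` the
`Γ_L`-subgroup with `resGal L (H') = H ∩ galRange L = H`): `→` lifts `t ∈ H'_{ι'}` to
`ι₂⁻¹ t ι₂ ∈ H_ι` (file 1) and uses injectivity of `ψ`; `←` is the equivariance. For Kobayashi's
layers: `ψ(E_L(L_m·E'))… ` — the layer points `E(K_{m,v})` seen from `L` and from `K` coincide.
[cite: Kobayashi2003, Def. 1.1 (p. 2), §2 p. 4] [cite: SerreGaloisCohomology1997, II.§1.1] -/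
theorem transportPoints_mem_localFixedPointsOfEmb_iff (Q : localPoints (W.baseChange L) E') :
    transportPoints L ι ι₂ ι' hcompat W Q ∈ localFixedPointsOfEmb ι W H ↔
      Q ∈ localFixedPointsOfEmb ι' (W.baseChange L) H' := by
  rw [mem_localFixedPointsOfEmb_iff, mem_localFixedPointsOfEmb_iff]
  constructor
  · intro hQ t ht
    have hmem := transportAut_symm_mem_localSubgroupOfEmb L ι ι₂ ι' hcompat f hf H H' hH'H t ht
    rw [mem_localSubgroupOfEmb_iff] at hmem
    apply (transportPoints_bijective L ι ι₂ ι' hcompat W).1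
    rw [← hQ _ hmem, ← transportPoints_transportAut_smul L ι ι₂ ι' hcompat hfixL W H H' hH hHH' _ hmem,
      transportAut_transportAut_symm]
  · intro hQ h hh
    rw [mem_localSubgroupOfEmb_iff] at hh
    rw [← transportPoints_transportAut_smul L ι ι₂ ι' hcompat hfixL W H H' hH hHH' h hh, hQ]
    rw [mem_localSubgroupOfEmb_iff]
    apply hHH'
    rw [resGal_resGalOfEmb_transportAut L ι ι₂ ι' hcompat]
    exact hh

end Fixed


/-! ## §2 Traces correspond -/

section Trace

variable (H₁ H₂ : Subgroup (Field.absoluteGaloisGroup K)) (H₁' H₂' : Subgroup (Field.absoluteGaloisGroup L))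
  [H₂.FiniteIndex] [H₂'.FiniteIndex]
  (hH₁ : H₁ ≤ galRange (K := K) L) (hH₂ : H₂ ≤ galRange (K := K) L)
  (h₁ : ∀ τ : Field.absoluteGaloisGroup L, resGal (K := K) L τ ∈ H₁ → τ ∈ H₁')
  (h₁' : ∀ τ : Field.absoluteGaloisGroup L, τ ∈ H₁' → resGal (K := K) L τ ∈ H₁)
  (h₂ : ∀ τ : Field.absoluteGaloisGroup L, resGal (K := K) L τ ∈ H₂ → τ ∈ H₂')
  (h₂' : ∀ τ : Field.absoluteGaloisGroup L, τ ∈ H₂' → resGal (K := K) L τ ∈ H₂)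

include hcompat f hf hfixL hH₁ hH₂ h₁ h₁' h₂ h₂' in
/-- **Traces correspond: `ψ (Tr^L_{H₂'/H₁'} Q) = Tr^K_{H₂/H₁} (ψ Q)`** for `Q` fixed by `(H₂')_{ι'}`.
`θ = ι₂(·)ι₂⁻¹ : (H₁)_ι → (H₁')_{ι'}` is a bijection carrying `(H₂)_ι` onto `(H₂')_{ι'}`, hence induces
a bijection of the coset spaces; the trace of a fixed point is the sum over ANY system of
representatives (`localPairTraceOfEmb_apply_eq_sum_of_mem`), and `ψ (θ g • Q) = g • ψ Q`. For the
towers: Kobayashi's `Tr_{n/m+1}` on `E_L(L_n'·E')` IS cc-typer-6's `Tr_{n/m+1}` on `E(K_{n,v})`.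
[cite: Kobayashi2003, Def. 1.1 (p. 2), §2 p. 4 (the trace maps Tr_{n/m+1})] [cite: SerreGaloisCohomology1997, II.§1.1] -/
theorem transportPoints_localPairTraceOfEmb {Q : localPoints (W.baseChange L) E'}
    (hQ : Q ∈ localFixedPointsOfEmb ι' (W.baseChange L) H₂') :
    transportPoints L ι ι₂ ι' hcompat W (localPairTraceOfEmb ι' (W.baseChange L) H₁' H₂' Q) =
      localPairTraceOfEmb ι W H₁ H₂ (transportPoints L ι ι₂ ι' hcompat W Q) := by
  set ψ := transportPoints L ι ι₂ ι' hcompat W with hψ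
  set A₁ := localSubgroupOfEmb H₁ ι with hA₁
  set A₂ := localSubgroupOfEmb H₂ ι with hA₂
  set B₁ := localSubgroupOfEmb H₁' ι' with hB₁
  set B₂ := localSubgroupOfEmb H₂' ι' with hB₂
  have hfix₁ : ∀ h : Field.absoluteGaloisGroup E, resGalOfEmb ι h ∈ H₁ → ∀ y : E',
      (show AlgebraicClosure E ≃ₐ[E] AlgebraicClosure E from h)
          (ι₂.symm (algebraMap E' (AlgebraicClosure E') y)) =
        ι₂.symm (algebraMap E' (AlgebraicClosure E') y) := fun g hg => hfixL g (hH₁ hg)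
  -- `θ : A₁ →ₜ* B₁`
  set θ := transportHom L H₁ H₁' h₁ ι ι₂ ι' hcompat hfix₁ with hθ
  have hθcoe : ∀ g : A₁, ((θ g : B₁) : Field.absoluteGaloisGroup E') =
      transportAut ι₂ (g : Field.absoluteGaloisGroup E) (hfix₁ g g.2) := fun _ => rfl
  have hθs : ∀ (g : A₁) (R : localPoints (W.baseChange L) E'),
      ψ (((θ g : B₁) : Field.absoluteGaloisGroup E') • R) = (g : Field.absoluteGaloisGroup E) • ψ R := by
    intro g R
    have key := transportPoints_smul L H₁ H₁' h₁ ι ι₂ ι' hcompat hfix₁ W g R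
    rw [Subgroup.smul_def, Subgroup.smul_def] at key
    exact key
  -- `θ` carries `A₂` onto `B₂`
  have hrn : ∀ g : A₁, (g : Field.absoluteGaloisGroup E) ∈ A₂ ↔
      ((θ g : B₁) : Field.absoluteGaloisGroup E') ∈ B₂ := by
    intro g
    rw [hA₂, hB₂, mem_localSubgroupOfEmb_iff, mem_localSubgroupOfEmb_iff, hθcoe]
    constructor
    · intro hg
      apply h₂
      rw [resGal_resGalOfEmb_transportAut L ι ι₂ ι' hcompat]
      exact hg
    · intro hg
      have h3 := h₂' _ hg
      rw [resGal_resGalOfEmb_transportAut L ι ι₂ ι' hcompat] at h3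
      exact h3
  -- `θ` is onto `B₁`
  have hθsurj : Function.Surjective θ := by
    intro b
    refine ⟨⟨transportAut ι₂.symm (b : Field.absoluteGaloisGroup E') (fix_symm ι₂ f hf b),
      transportAut_symm_mem_localSubgroupOfEmb L ι ι₂ ι' hcompat f hf H₁ H₁' h₁' b b.2⟩,
      Subtype.ext ?_⟩
    rw [hθcoe]
    exact transportAut_transportAut_symm ι₂ (b : Field.absoluteGaloisGroup E') (fix_symm ι₂ f hf b)
      (hfix₁ _ (transportAut_symm_mem_localSubgroupOfEmb L ι ι₂ ι' hcompat f hf H₁ H₁' h₁' b b.2))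
  haveI : Fintype (A₁ ⧸ A₂.subgroupOf A₁) := Fintype.ofFinite _
  haveI : Fintype (B₁ ⧸ B₂.subgroupOf B₁) := Fintype.ofFinite _
  -- representatives on the `K`-side and their images
  let s₂ : A₁ ⧸ A₂.subgroupOf A₁ → A₁ := fun q => q.out
  have hs₂ : ∀ q, ((s₂ q : A₁) : A₁ ⧸ A₂.subgroupOf A₁) = q := fun q => q.out_eq
  let φ : A₁ ⧸ A₂.subgroupOf A₁ → B₁ ⧸ B₂.subgroupOf B₁ := fun q => (θ (s₂ q) : B₁)
  have hφmk : ∀ g : A₁, φ (g : A₁ ⧸ A₂.subgroupOf A₁) = (θ g : B₁ ⧸ B₂.subgroupOf B₁) := by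
    intro g
    apply QuotientGroup.eq.mpr
    rw [Subgroup.mem_subgroupOf, ← map_inv, ← map_mul, ← hrn]
    have h := QuotientGroup.eq.mp (hs₂ (g : A₁ ⧸ A₂.subgroupOf A₁))
    rw [Subgroup.mem_subgroupOf] at h
    exact h
  have hφinj : Function.Injective φ := by
    intro a b hab
    rw [← hs₂ a, ← hs₂ b]
    apply QuotientGroup.eq.mpr
    rw [Subgroup.mem_subgroupOf]
    have h := QuotientGroup.eq.mp hab
    rw [Subgroup.mem_subgroupOf, ← map_inv, ← map_mul, ← hrn] at h
    exact h
  have hφsurj : Function.Surjective φ := by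
    intro q
    induction q using QuotientGroup.induction_on with
    | H b =>
      obtain ⟨g, rfl⟩ := hθsurj b
      exact ⟨(g : A₁ ⧸ A₂.subgroupOf A₁), hφmk g⟩
  let e : (A₁ ⧸ A₂.subgroupOf A₁) ≃ (B₁ ⧸ B₂.subgroupOf B₁) := Equiv.ofBijective φ ⟨hφinj, hφsurj⟩
  -- the transported system of representatives on the `L`-side
  let s₁ : B₁ ⧸ B₂.subgroupOf B₁ → B₁ := fun q => θ (s₂ (e.symm q))
  have hs₁ : ∀ q, ((s₁ q : B₁) : B₁ ⧸ B₂.subgroupOf B₁) = q := fun q => by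
    change φ (e.symm q) = q
    exact e.apply_symm_apply q
  -- both traces as sums over representatives
  have hψQ : ψ Q ∈ localFixedPointsOfEmb ι W H₂ :=
    (transportPoints_mem_localFixedPointsOfEmb_iff L ι ι₂ ι' hcompat f hf hfixL W H₂ H₂' hH₂ h₂ h₂' Q).mpr hQ
  rw [localPairTraceOfEmb_apply_eq_sum_of_mem ι' (W.baseChange L) (H₁ := H₁') (H₂ := H₂') hQ s₁ hs₁,
    localPairTraceOfEmb_apply_eq_sum_of_mem ι W (H₁ := H₁) (H₂ := H₂) hψQ s₂ hs₂, map_sum, ← e.sum_comp]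
  refine Finset.sum_congr rfl fun q _ => ?_
  rw [hθs, e.symm_apply_apply]

end Trace


/-! ## §3 Kobayashi's plus local points over the `κL`-layers = the tower plus local points over `U` -/

section Signed

variable {p : ℕ} [Fact p.Prime] (U : ℕ → Subgroup (Field.absoluteGaloisGroup K))
  [hUfin : ∀ m, (U m).FiniteIndex] (hU : ∀ m, U m ≤ galRange (K := K) L)
  (κL : ZpExtension L p)
  (hκU : ∀ (m : ℕ) (τ : Field.absoluteGaloisGroup L), τ ∈ κL.layerSubgroup m ↔ resGal (K := K) L τ ∈ U m)

omit hUfin in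
include hcompat f hf hfixL hU hκU in
/-- **Layer points correspond**: `ψ Q ∈ E(K_m·?)` — precisely, `ψ Q` is fixed by `(U m)_ι` IFF `Q`
lies in Kobayashi's layer points `localLayerPointsOfEmb κL ι' W_L m` (the `κL`-layer is `res⁻¹(U m)`).
[cite: Kobayashi2003, Def. 1.1 (p. 2), §2 p. 4] -/
theorem transportPoints_mem_localFixedPointsOfEmb_iff_mem_localLayerPointsOfEmb (m : ℕ)
    (Q : localPoints (W.baseChange L) E') :
    transportPoints L ι ι₂ ι' hcompat W Q ∈ localFixedPointsOfEmb ι W (U m) ↔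
      Q ∈ Kobayashi2003.localLayerPointsOfEmb κL ι' (W.baseChange L) m := by
  rw [localLayerPointsOfEmb_eq]
  exact transportPoints_mem_localFixedPointsOfEmb_iff L ι ι₂ ι' hcompat f hf hfixL W (U m)
    (κL.layerSubgroup m) (hU m) (fun τ h => (hκU m τ).mpr h) (fun τ h => (hκU m τ).mp h) Q

include hcompat f hf hfixL hU hκU in
/-- **Kobayashi's traces = the tower traces under `ψ`**: for `Q` in the `k`-th layer points,
`ψ (Tr_{k/m} Q) = Tr_{(U k)/(U m)} (ψ Q)` (§2 with the `κL`-layers `res⁻¹(U m)`, `res⁻¹(U k)`).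
[cite: Kobayashi2003, Def. 1.1 (p. 2), §2 p. 4 (Tr_{n/m+1})] -/
theorem transportPoints_localTraceOfEmb (m k : ℕ) {Q : localPoints (W.baseChange L) E'}
    (hQ : Q ∈ Kobayashi2003.localLayerPointsOfEmb κL ι' (W.baseChange L) k) :
    transportPoints L ι ι₂ ι' hcompat W (Kobayashi2003.localTraceOfEmb κL ι' (W.baseChange L) m k Q) =
      localPairTraceOfEmb ι W (U m) (U k) (transportPoints L ι ι₂ ι' hcompat W Q) := by
  rw [localLayerPointsOfEmb_eq] at hQ
  rw [localTraceOfEmb_eq_localPairTraceOfEmb]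
  exact transportPoints_localPairTraceOfEmb L ι ι₂ ι' hcompat f hf hfixL W (U m) (U k)
    (κL.layerSubgroup m) (κL.layerSubgroup k) (hU m) (hU k)
    (fun τ h => (hκU m τ).mpr h) (fun τ h => (hκU m τ).mp h)
    (fun τ h => (hκU k τ).mpr h) (fun τ h => (hκU k τ).mp h) hQ

include hcompat f hf hfixL hU hκU in
/-- **Kobayashi's PLUS local points over the `κL`-layers are carried by `ψ` ONTO cc-typer-6's plus
local points over the tower `U`**: `ψ(E⁺_{Def 1.1}(L_n·E')) = E⁺_{§2}(K-side, U, n)` — both are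
«layer-`n` points whose traces `Tr_{n/m+1}` land in the layer-`m` points for every even `m < n`»,
and layer points / traces correspond (§1, §2). In the crux: Kobayashi's `E⁺(F_𝔭·F_n)` for `V_F`
IS the tower plus group of `V` over `ℚ_p·F·ℚ_n` — no index-2 discrepancy at the ramified prime.
[cite: Kobayashi2003, Def. 1.1 (p. 2), §2 p. 4, Def. 2.1 (p. 5)] -/
theorem map_transportPoints_signedLocalPointsOfEmb_one (n : ℕ) :
    (Kobayashi2003.signedLocalPointsOfEmb κL ι' (W.baseChange L) 1 n).map
        (transportPoints L ι ι₂ ι' hcompat W) =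
      towerSignedLocalPointsOfEmb U ι W 1 n := by
  have hfp := transportPoints_mem_localFixedPointsOfEmb_iff_mem_localLayerPointsOfEmb L ι ι₂ ι'
    hcompat f hf hfixL W U hU κL hκU
  have htr := fun m k Q hQ => transportPoints_localTraceOfEmb L ι ι₂ ι' hcompat f hf hfixL W U hU
    κL hκU m k (Q := Q) hQ
  ext P
  rw [AddSubgroup.mem_map]
  constructor
  · rintro ⟨Q, hQ, rfl⟩
    rw [Kobayashi2003.mem_signedLocalPointsOfEmb_one_iff] at hQ
    rw [mem_towerSignedLocalPointsOfEmb_one_iff]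
    refine ⟨(hfp n Q).mpr hQ.1, fun m hm hev => ?_⟩
    rw [← htr (m + 1) n Q hQ.1, hfp]
    exact hQ.2 m hm hev
  · intro hP
    rw [mem_towerSignedLocalPointsOfEmb_one_iff] at hP
    obtain ⟨Q, rfl⟩ := (transportPoints_bijective L ι ι₂ ι' hcompat W).2 P
    refine ⟨Q, ?_, rfl⟩
    rw [Kobayashi2003.mem_signedLocalPointsOfEmb_one_iff]
    have hQn : Q ∈ Kobayashi2003.localLayerPointsOfEmb κL ι' (W.baseChange L) n := (hfp n Q).mp hP.1
    refine ⟨hQn, fun m hm hev => ?_⟩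
    rw [← hfp, htr (m + 1) n Q hQn]
    exact hP.2 m hm hev

end Signed

end Summit.BirchSwinnertonDyer.BirchSwinnertonDyer.Theorems.EtaLayer

end
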